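import Literature.Analysis.ODE.CompactSupportFlow
import Literature.Topology.PlaneTopology.SmoothUmlaufsatz
import Mathlib.Analysis.Calculus.InverseFunctionTheorem.ContDiff
import Mathlib.Analysis.SpecialFunctions.SmoothTransition
import Mathlib.Topology.Algebra.Order.Archimedean
import HarnessLib

/-!
# Orbits of a nowhere-vanishing planar vector field with a global angle are unbounded

Topic `Literature/Analysis/ODE` (planar dynamics; uses the global flow of `CompactSupportFlow.lean`
and Hopf's Umlaufsatz of `Literature/Topology/PlaneTopology/SmoothUmlaufsatz.lean`). This is the
part of the Poincaré–Bendixson theory behind Smale's proof that `Diff(D² rel ∂)` is connected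
(S. Smale, Proc. AMS 10 (1959), Thm. B: the orbits of a nowhere-vanishing field on the square
standard near the boundary cross the square), in the following pointed form.

Let `X : ℂ → ℂ` be a vector field of class `C¹`, bounded and globally Lipschitz (so that its
global flow `Literature.Analysis.ODE.globalFlow` is defined), nowhere zero, and admitting a
**continuous global logarithm** (`Literature.Topology.PlaneTopology.HasLogOn X univ`; for a
nowhere-vanishing field this means that its direction `X/‖X‖ : ℂ → S¹` has a continuous angle,
which is automatic on simply connected domains but is stated as a hypothesis since it is what the
proof uses, and it is how the fields `e^{iτθ}` of Smale's proof come). Then: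

* `false_of_globalFlow_eq_self` — **`X` has no closed orbits**: `Φ_P p = p` with `P ≠ 0` is
  impossible. (The periods of `p` form a closed subgroup of `ℝ`, not all of `ℝ` since `X p ≠ 0`,
  hence cyclic (`AddSubgroup.dense_or_cyclic`); for the least period `P₀` the orbit is a regular
  closed `C¹` curve injective modulo `P₀`, whose velocity loop `X ∘ orbit` winds `±1` times about
  `0` by the Umlaufsatz, and `0` times since it is the exponential of a periodic continuous
  function.) This is Hartman, *ODE*, Thm. VII.3.1 for fields without stationary points.
* `exists_lt_norm_globalFlow` — **every forward semi-orbit is unbounded**: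
  `∀ z₀ R, ∃ t ≥ 0, R < ‖Φ_t z₀‖`; `exists_lt_norm_globalFlow_of_nonpos` — the same backward.
  Proof (a short-cut through the Poincaré–Bendixson argument, Hartman, *ODE*, VII §4): a bounded
  forward orbit has an `ω`-limit point `q`; in the flow box `Ψ (t, r) = Φ_t (q + r i X(q))` at `q`
  (a `C¹` diffeomorphism near `0` by the inverse function theorem) the orbit hits the transversal
  `Ψ (0, ·)` at arbitrarily late, `δ₀`-separated times; two consecutive hits `t₁ < t₂` occur at
  distinct heights `r₁ ≠ r₂` (no closed orbits), and the closed curve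
  `E v = Ψ (v - δ, g v)` — where `g` descends smoothly from `r₂` to `r₁` over `[0, 2δ]` and is
  constant outside, so that `E` Is the orbit itself off `[0, 2δ]` — is a `C¹` curve of period
  `t₂ - t₁`, injective modulo the period, with velocity `X(E) (1 + ζ)`, `|ζ| ≤ 1/2` (the hit
  window is chosen small against the flow-box distortion). The field `X ∘ E` is thus never
  opposite to the velocity, so it winds `±1` times (`wind_eq_one_or_eq_neg_one_of_div_mem_slitPlane`)
  — and `0` times, being an exponential. Contradiction.

Everything here is proved; there are no definitions and no named facts.

## References

* P. Hartman, *Ordinary Differential Equations*, Classics in Applied Mathematics 38, SIAM (2002),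
  Ch. VII, Thm. 3.1 and §4 (Poincaré–Bendixson). [Hartman2002]
* S. Smale, *Diffeomorphisms of the 2-sphere*, Proc. Amer. Math. Soc. 10 (1959) 621–626, proof
  of Thm. B.
* H. Hopf, Compositio Math. 2 (1935), Satz I (the Umlaufsatz, `SmoothUmlaufsatz.lean`). [Hopf1935]
-/

noncomputable section

open Complex Set Filter Function Metric Topology
open scoped Real NNReal
open Literature.Topology.PlaneTopology

namespace Literature.Analysis.ODE

/-! ### The smooth transition function has vanishing derivative off `(0, 1)` -/

/-- The derivative of `Real.smoothTransition` vanishes on `(-∞, 0]` and on `[1, ∞)`, and is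
bounded. [folklore] -/
theorem deriv_smoothTransition_eq_zero :
    (∀ x ≤ 0, deriv Real.smoothTransition x = 0) ∧ (∀ x, 1 ≤ x → deriv Real.smoothTransition x = 0) ∧
      ∃ C : ℝ, 0 < C ∧ ∀ x, |deriv Real.smoothTransition x| ≤ C := by
  have hC : ContDiff ℝ 1 Real.smoothTransition := Real.smoothTransition.contDiff
  have hc : Continuous (deriv Real.smoothTransition) := hC.continuous_deriv le_rfl
  have hclosed : IsClosed {x : ℝ | deriv Real.smoothTransition x = 0} := isClosed_eq hc continuous_const
  -- vanishing on the open pieces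
  have hneg : ∀ x < 0, deriv Real.smoothTransition x = 0 := by
    intro x hx
    have : Real.smoothTransition =ᶠ[𝓝 x] fun _ => (0 : ℝ) :=
      (eventually_lt_nhds hx).mono fun y hy => Real.smoothTransition.zero_of_nonpos hy.le
    rw [this.deriv_eq, deriv_const]
  have hpos : ∀ x, 1 < x → deriv Real.smoothTransition x = 0 := by
    intro x hx
    have : Real.smoothTransition =ᶠ[𝓝 x] fun _ => (1 : ℝ) :=
      (eventually_gt_nhds hx).mono fun y hy => Real.smoothTransition.one_of_one_le hy.le
    rw [this.deriv_eq, deriv_const]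
  -- the closed zero set contains the closures
  have h0 : ∀ x ≤ 0, deriv Real.smoothTransition x = 0 := by
    intro x hx
    have hsub : Iio (0 : ℝ) ⊆ {x : ℝ | deriv Real.smoothTransition x = 0} := fun y hy => hneg y hy
    have := closure_minimal hsub hclosed
    rw [closure_Iio] at this
    exact this hx
  have h1 : ∀ x, 1 ≤ x → deriv Real.smoothTransition x = 0 := by
    intro x hx
    have hsub : Ioi (1 : ℝ) ⊆ {x : ℝ | deriv Real.smoothTransition x = 0} := fun y hy => hpos y hy
    have := closure_minimal hsub hclosed
    rw [closure_Ioi] at this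
    exact this hx
  refine ⟨h0, h1, ?_⟩
  obtain ⟨C, hC⟩ := isCompact_Icc.exists_bound_of_continuousOn (s := Icc (0 : ℝ) 1) hc.continuousOn
  refine ⟨max C 1, lt_max_of_lt_right one_pos, fun x => ?_⟩
  by_cases hx : x ∈ Icc (0 : ℝ) 1
  · exact ((Real.norm_eq_abs _).symm.le.trans (hC x hx)).trans (le_max_left _ _)
  · rw [mem_Icc, not_and_or, not_le, not_le] at hx
    rcases hx with hx | hx
    · rw [h0 x hx.le, abs_zero]; positivity
    · rw [h1 x hx.le, abs_zero]; positivity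

/-! ### The global flow of a bounded Lipschitz field: elementary consequences -/

section Flow

variable {X : ℂ → ℂ} {K : ℝ≥0} {B : ℝ}

/-- The flow curves are `C¹` when the field is. [folklore] -/
theorem contDiff_globalFlow_apply (hX : ContDiff ℝ 1 X) (hK : LipschitzWith K X)
    (hB : ∀ z, ‖X z‖ ≤ B) (z : ℂ) : ContDiff ℝ 1 fun t : ℝ => globalFlow hK hB z t :=
  (contDiff_globalFlow hX le_rfl hK hB).comp (contDiff_const.prodMk contDiff_id)

/-- The derivative of a flow curve is the field. [folklore] -/
theorem deriv_globalFlow (hK : LipschitzWith K X) (hB : ∀ z, ‖X z‖ ≤ B) (z : ℂ) (t : ℝ) :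
    deriv (fun t : ℝ => globalFlow hK hB z t) t = X (globalFlow hK hB z t) :=
  (hasDerivAt_globalFlow hK hB z t).deriv

/-- **The field does not vanish, so no point is fixed by all times.** If `Φ_τ p = p` for all
`τ` then `X p = 0`. [folklore] -/
theorem eq_zero_of_forall_globalFlow_eq (hK : LipschitzWith K X) (hB : ∀ z, ‖X z‖ ≤ B) {p : ℂ}
    (h : ∀ τ, globalFlow hK hB p τ = p) : X p = 0 := by
  have h1 : HasDerivAt (fun τ : ℝ => globalFlow hK hB p τ) (X (globalFlow hK hB p 0)) 0 :=
    hasDerivAt_globalFlow hK hB p 0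
  rw [globalFlow_zero] at h1
  have h2 : HasDerivAt (fun _ : ℝ => p) 0 0 := hasDerivAt_const 0 p
  have h3 : (fun τ : ℝ => globalFlow hK hB p τ) = fun _ => p := funext h
  rw [h3] at h1
  exact h1.unique h2

/-- If `Φ_s p` is fixed by time `τ`, so is `p` (the flow is a commutative group action of `ℝ`).
[folklore] -/
theorem globalFlow_eq_self_of_globalFlow (hK : LipschitzWith K X) (hB : ∀ z, ‖X z‖ ≤ B) {p : ℂ}
    {s τ : ℝ} (h : globalFlow hK hB (globalFlow hK hB p s) τ = globalFlow hK hB p s) :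
    globalFlow hK hB p τ = p := by
  have e1 : globalFlow hK hB p τ = globalFlow hK hB (globalFlow hK hB p (s + τ)) (-s) := by
    rw [← globalFlow_add, show s + τ + -s = τ by ring]
  rw [e1, globalFlow_add, h, globalFlow_neg_globalFlow]

/-- **A nowhere-vanishing field with a continuous global logarithm has no closed orbits**
(Hartman, *ODE*, Thm. VII.3.1, for fields without stationary points): `Φ_P p = p` with `P ≠ 0`
is impossible. See the module docstring. [cite: Hartman2002, Ch. VII Thm. 3.1] -/
theorem false_of_globalFlow_eq_self (hX : ContDiff ℝ 1 X) (hK : LipschitzWith K X)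
    (hB : ∀ z, ‖X z‖ ≤ B) (hX0 : ∀ z, X z ≠ 0) (hlog : HasLogOn X univ) {p : ℂ} {P : ℝ}
    (hP : P ≠ 0) (hfix : globalFlow hK hB p P = p) : False := by
  -- the closed subgroup of periods of `p`
  set G : AddSubgroup ℝ :=
    { carrier := {τ | globalFlow hK hB p τ = p}
      zero_mem' := globalFlow_zero hK hB p
      add_mem' := fun {a b} ha hb => by
        show globalFlow hK hB p (a + b) = p
        rw [globalFlow_add, show globalFlow hK hB p a = p from ha]; exact hb
      neg_mem' := fun {a} ha => by
        show globalFlow hK hB p (-a) = p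
        have := globalFlow_neg_globalFlow hK hB p a
        rwa [show globalFlow hK hB p a = p from ha] at this } with hG
  have hmem : ∀ τ, τ ∈ G ↔ globalFlow hK hB p τ = p := fun τ => Iff.rfl
  have hclosed : IsClosed (G : Set ℝ) :=
    isClosed_eq (continuous_globalFlow hK hB p) continuous_const
  rcases G.dense_or_cyclic with hd | ⟨a, ha⟩
  · -- dense and closed: every time fixes `p`, so `X p = 0`
    have huniv : (G : Set ℝ) = univ := by rw [← hclosed.closure_eq, hd.closure_eq]
    refine hX0 p (eq_zero_of_forall_globalFlow_eq hK hB fun τ => ?_)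
    have : τ ∈ (G : Set ℝ) := by rw [huniv]; exact mem_univ τ
    exact this
  · -- cyclic with generator `a ≠ 0`: the least period `P₀ = |a|`
    have hPG : P ∈ G := hfix
    rw [ha, AddSubgroup.mem_closure_singleton] at hPG
    obtain ⟨n, hn⟩ := hPG
    have ha0 : a ≠ 0 := by rintro rfl; simp at hn; exact hP hn.symm
    set P₀ : ℝ := |a| with hP₀
    have hP₀0 : 0 < P₀ := abs_pos.2 ha0
    have haG : ∀ m : ℤ, globalFlow hK hB p (m • a) = p := fun m => by
      rw [← hmem, ha, AddSubgroup.mem_closure_singleton]; exact ⟨m, rfl⟩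
    have hP₀G : globalFlow hK hB p P₀ = p := by
      rcases abs_choice a with h | h
      · rw [hP₀, h]; simpa using haG 1
      · rw [hP₀, h]; simpa using haG (-1)
    -- the closed orbit as a periodic `C¹` curve
    have hcC : ContDiff ℝ 1 fun t : ℝ => globalFlow hK hB p t := contDiff_globalFlow_apply hX hK hB p
    have hcper : Periodic (fun t : ℝ => globalFlow hK hB p t) P₀ := fun t => by
      show globalFlow hK hB p (t + P₀) = globalFlow hK hB p t
      rw [add_comm, globalFlow_add, hP₀G]
    have hcinj : ∀ ⦃s t : ℝ⦄, globalFlow hK hB p s = globalFlow hK hB p t → ∃ m : ℤ, t = s + m * P₀ := by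
      intro s t hst
      have h1 : globalFlow hK hB (globalFlow hK hB p s) (t - s) = globalFlow hK hB p s := by
        rw [← globalFlow_add, show s + (t - s) = t by ring, hst]
      have h2 : t - s ∈ G := globalFlow_eq_self_of_globalFlow hK hB h1
      rw [ha, AddSubgroup.mem_closure_singleton] at h2
      obtain ⟨m, hm⟩ := h2
      rw [zsmul_eq_mul] at hm
      rcases abs_choice a with h | h
      · exact ⟨m, by rw [hP₀, h]; linarith⟩
      · exact ⟨-m, by rw [hP₀, h]; push_cast; linarith⟩
    have hcreg : ∀ t, deriv (fun t : ℝ => globalFlow hK hB p t) t ≠ 0 := fun t => by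
      rw [deriv_globalFlow]; exact hX0 _
    -- the Umlaufsatz: the velocity loop winds `±1` times
    have hw := wind_deriv_eq_one_or_eq_neg_one hP₀0 hcC hcper hcinj hcreg
    -- but it is an exponential of a periodic continuous function: it winds `0` times
    obtain ⟨Θ, hΘc, hΘe⟩ := hlog
    have hΘc' : Continuous Θ := continuousOn_univ.1 hΘc
    have hloop : (fun u : ℝ => deriv (fun t : ℝ => globalFlow hK hB p t) (P₀ * u)) =
        fun u => exp (Θ (globalFlow hK hB p (P₀ * u))) := by
      funext u
      rw [deriv_globalFlow, hΘe _ (mem_univ _)]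
    have hw0 : wind (fun u : ℝ => deriv (fun t : ℝ => globalFlow hK hB p t) (P₀ * u)) = 0 := by
      rw [hloop]
      refine wind_exp_eq_zero ?_ ?_
      · exact (hΘc'.comp ((continuous_globalFlow hK hB p).comp (continuous_const.mul continuous_id))).continuousOn
      · simp only [mul_zero, mul_one]
        rw [show globalFlow hK hB p P₀ = globalFlow hK hB p 0 by rw [hP₀G, globalFlow_zero]]
    rw [hw0] at hw
    norm_num at hw


/-! ### The flow box at a point -/

/-- A continuous linear map on `ℝ × ℝ` is determined by its values on `(1, 0)` and `(0, 1)`.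
[folklore] -/
theorem clm_prod_ext {F : Type*} [NormedAddCommGroup F] [NormedSpace ℝ F] {f g : (ℝ × ℝ) →L[ℝ] F}
    (h1 : f (1, 0) = g (1, 0)) (h2 : f (0, 1) = g (0, 1)) : f = g := by
  refine ContinuousLinearMap.ext fun p => ?_
  have e : p = p.1 • ((1 : ℝ), (0 : ℝ)) + p.2 • ((0 : ℝ), (1 : ℝ)) := by ext <;> simp
  rw [e, map_add, map_add, map_smul, map_smul, map_smul, map_smul, h1, h2]

/-- Multiplication by a nonzero complex number, precomposed with `ℝ × ℝ ≃ ℂ`, as a real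
continuous linear equivalence `(a, b) ↦ w (a + b i)`. [folklore] -/
theorem exists_clEquiv_mul (w : ℂ) (hw : w ≠ 0) :
    ∃ L : (ℝ × ℝ) ≃L[ℝ] ℂ, ∀ p : ℝ × ℝ, L p = w * (p.1 + p.2 * I) := by
  refine ⟨ContinuousLinearEquiv.equivOfInverse
    ((ContinuousLinearMap.mul ℝ ℂ w).comp (equivRealProdCLM.symm : (ℝ × ℝ) →L[ℝ] ℂ))
    ((equivRealProdCLM : ℂ →L[ℝ] (ℝ × ℝ)).comp (ContinuousLinearMap.mul ℝ ℂ w⁻¹))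
    (fun p => ?_) (fun z => ?_), fun p => ?_⟩
  · simp only [ContinuousLinearMap.coe_comp, Function.comp_apply, ContinuousLinearMap.mul_apply',
      ContinuousLinearEquiv.coe_coe]
    rw [inv_mul_cancel_left₀ hw, ContinuousLinearEquiv.apply_symm_apply]
  · simp only [ContinuousLinearMap.coe_comp, Function.comp_apply, ContinuousLinearMap.mul_apply',
      ContinuousLinearEquiv.coe_coe]
    rw [ContinuousLinearEquiv.symm_apply_apply, mul_inv_cancel_left₀ hw]
  · simp only [ContinuousLinearEquiv.equivOfInverse_apply, ContinuousLinearMap.coe_comp,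
      Function.comp_apply, ContinuousLinearMap.mul_apply', ContinuousLinearEquiv.coe_coe,
      equivRealProdCLM_symm_apply]

/-- **The partial derivative of the flow box in the time direction is the field**: for
`Ψ (t, r) = Φ_t (q + r v)` one has `DΨ(p) (1, 0) = X (Ψ p)`. [folklore] -/
theorem fderiv_flowBox_one_zero (hX : ContDiff ℝ 1 X) (hK : LipschitzWith K X)
    (hB : ∀ z, ‖X z‖ ≤ B) (q v : ℂ) (p : ℝ × ℝ) :
    fderiv ℝ (fun p : ℝ × ℝ => globalFlow hK hB (q + (p.2 : ℂ) * v) p.1) p ((1 : ℝ), (0 : ℝ)) =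
      X (globalFlow hK hB (q + (p.2 : ℂ) * v) p.1) := by
  have hΨ : ContDiff ℝ 1 fun p : ℝ × ℝ => globalFlow hK hB (q + (p.2 : ℂ) * v) p.1 :=
    (contDiff_globalFlow hX le_rfl hK hB).comp
      ((contDiff_const.add ((ofRealCLM.contDiff.comp contDiff_snd).mul contDiff_const)).prodMk contDiff_fst)
  have h1 : HasFDerivAt (fun p : ℝ × ℝ => globalFlow hK hB (q + (p.2 : ℂ) * v) p.1)
      (fderiv ℝ (fun p : ℝ × ℝ => globalFlow hK hB (q + (p.2 : ℂ) * v) p.1) p) p :=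
    (hΨ.differentiable (by simp) p).hasFDerivAt
  -- restrict to the line `t ↦ (t, p.2)`
  have h2 : HasDerivAt (fun t : ℝ => ((t, p.2) : ℝ × ℝ)) ((1 : ℝ), (0 : ℝ)) p.1 :=
    (hasDerivAt_id p.1).prodMk (hasDerivAt_const p.1 p.2)
  have h3 := h1.comp_hasDerivAt p.1 h2
  have h4 : HasDerivAt (fun t : ℝ => globalFlow hK hB (q + (p.2 : ℂ) * v) t)
      (X (globalFlow hK hB (q + (p.2 : ℂ) * v) p.1)) p.1 := hasDerivAt_globalFlow hK hB _ p.1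
  exact h3.unique h4

/-- **The flow box** at a regular point `q` of the field: `Ψ (t, r) = Φ_t (q + r · i X(q))` is
injective on a closed square `max (|t|, |r|) ≤ δ₀`, and the image of every smaller open square
is a neighbourhood of `q` (inverse function theorem: `DΨ(0) (a, b) = (a + b i) X(q)` is
invertible). Hartman, *ODE*, VII §4, step (a). [cite: Hartman2002, Ch. VII §4] -/
theorem exists_flowBox (hX : ContDiff ℝ 1 X) (hK : LipschitzWith K X) (hB : ∀ z, ‖X z‖ ≤ B)
    (q : ℂ) (hq : X q ≠ 0) :
    ∃ δ₀ : ℝ, 0 < δ₀ ∧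
      InjOn (fun p : ℝ × ℝ => globalFlow hK hB (q + (p.2 : ℂ) * (I * X q)) p.1) (closedBall 0 δ₀) ∧
      ∀ δ₁ : ℝ, 0 < δ₁ → δ₁ ≤ δ₀ → ∃ η : ℝ, 0 < η ∧
        ball q η ⊆ (fun p : ℝ × ℝ => globalFlow hK hB (q + (p.2 : ℂ) * (I * X q)) p.1) '' ball 0 δ₁ := by
  set Ψ : ℝ × ℝ → ℂ := fun p => globalFlow hK hB (q + (p.2 : ℂ) * (I * X q)) p.1 with hΨ_def
  have hΨ : ContDiff ℝ 1 Ψ :=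
    (contDiff_globalFlow hX le_rfl hK hB).comp
      ((contDiff_const.add ((ofRealCLM.contDiff.comp contDiff_snd).mul contDiff_const)).prodMk contDiff_fst)
  have hΨ0 : Ψ 0 = q := by simp [hΨ_def]
  -- the derivative at `0`
  obtain ⟨L, hL⟩ := exists_clEquiv_mul (X q) hq
  have hD : HasFDerivAt Ψ (L : (ℝ × ℝ) →L[ℝ] ℂ) 0 := by
    have h1 : HasFDerivAt Ψ (fderiv ℝ Ψ 0) 0 := (hΨ.differentiable (by simp) 0).hasFDerivAt
    have he : fderiv ℝ Ψ 0 = (L : (ℝ × ℝ) →L[ℝ] ℂ) := by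
      refine clm_prod_ext ?_ ?_
      · rw [ContinuousLinearEquiv.coe_coe, hL]
        have := fderiv_flowBox_one_zero hX hK hB q (I * X q) 0
        simp only [Prod.snd_zero, Prod.fst_zero, ofReal_zero, zero_mul, add_zero, globalFlow_zero] at this
        rw [this]; simp
      · rw [ContinuousLinearEquiv.coe_coe, hL]
        -- restrict to the line `r ↦ (0, r)`, along which `Ψ (0, r) = q + r (i X q)`
        have h2 : HasDerivAt (fun r : ℝ => (((0 : ℝ), r) : ℝ × ℝ)) ((0 : ℝ), (1 : ℝ)) 0 :=
          (hasDerivAt_const (0 : ℝ) (0 : ℝ)).prodMk (hasDerivAt_id 0)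
        have h3 := h1.comp_hasDerivAt (0 : ℝ) h2
        have h4 : HasDerivAt (fun r : ℝ => q + (r : ℂ) * (I * X q)) (I * X q) 0 := by
          simpa using ((hasDerivAt_id (0 : ℝ)).ofReal_comp.mul_const (I * X q)).const_add q
        have h5 : (Ψ ∘ fun r : ℝ => (((0 : ℝ), r) : ℝ × ℝ)) = fun r : ℝ => q + (r : ℂ) * (I * X q) := by
          funext r; simp [hΨ_def]
        rw [h5] at h3
        rw [h3.unique h4]
        simp; ring
    rw [← he]; exact h1
  -- the inverse function theorem
  set Φ := hΨ.contDiffAt.toOpenPartialHomeomorph Ψ hD (by simp) with hΦ_def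
  have hsrc : (0 : ℝ × ℝ) ∈ Φ.source := hΨ.contDiffAt.mem_toOpenPartialHomeomorph_source hD (by simp)
  have hcoe : (Φ : ℝ × ℝ → ℂ) = Ψ := rfl
  obtain ⟨ρ, hρ0, hρ⟩ := Metric.mem_nhds_iff.1 (Φ.open_source.mem_nhds hsrc)
  refine ⟨ρ / 2, half_pos hρ0, ?_, fun δ₁ hδ₁ hδ₁' => ?_⟩
  · intro p hp p' hp' h
    have hsub : closedBall (0 : ℝ × ℝ) (ρ / 2) ⊆ Φ.source :=
      (closedBall_subset_ball (by linarith)).trans hρ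
    exact Φ.injOn (hsub hp) (hsub hp') h
  · have himg : Φ '' ball 0 δ₁ ∈ 𝓝 (Φ 0) := Φ.image_mem_nhds hsrc (ball_mem_nhds 0 hδ₁)
    rw [hcoe, hΨ0] at himg
    obtain ⟨η, hη0, hη⟩ := Metric.mem_nhds_iff.1 himg
    exact ⟨η, hη0, hη⟩

/-! ### Auxiliary estimates -/

/-- If `‖d‖ ≤ ‖a‖ / 2` with `a ≠ 0` then `a + d ≠ 0` and `a / (a + d)` lies in the slit plane
(it has positive real part). [folklore] -/
theorem div_add_mem_slitPlane {a d : ℂ} (ha : a ≠ 0) (hd : ‖d‖ ≤ ‖a‖ / 2) :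
    a + d ≠ 0 ∧ a / (a + d) ∈ slitPlane := by
  have ha' : 0 < ‖a‖ := norm_pos_iff.2 ha
  set u : ℂ := d / a with hu
  have hu1 : ‖u‖ ≤ 1 / 2 := by
    rw [hu, norm_div, div_le_iff₀ ha']; linarith
  have had : a + d = a * (1 + u) := by rw [hu]; field_simp
  have hre : 1 / 2 ≤ (1 + u).re := by
    have := abs_re_le_norm u
    rw [add_re, one_re]
    linarith [abs_le.1 (this.trans hu1) |>.1]
  have h1u : 1 + u ≠ 0 := fun h => by
    have := congrArg Complex.re h
    rw [zero_re] at this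
    linarith
  refine ⟨by rw [had]; exact mul_ne_zero ha h1u, ?_⟩
  have e : a / (a + d) = (1 + u)⁻¹ := by
    rw [had, div_mul_eq_div_div, div_self ha, one_div]
  rw [e]
  left
  rw [inv_re]
  exact div_pos (by linarith) (normSq_pos.2 h1u)

/-- Points of the closed square of side `2δ₀`. [folklore] -/
theorem mk_mem_closedBall_prod {δ₀ a b : ℝ} (ha : |a| ≤ δ₀) (hb : |b| ≤ δ₀) :
    ((a, b) : ℝ × ℝ) ∈ closedBall (0 : ℝ × ℝ) δ₀ := by
  rw [mem_closedBall_zero_iff, Prod.norm_mk, Real.norm_eq_abs, Real.norm_eq_abs]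
  exact max_le ha hb

/-! ### The escape theorem -/

/-- **Every forward semi-orbit of a nowhere-vanishing planar `C¹` field with a continuous global
logarithm is unbounded**: for every starting point `z₀` and every radius `R` the orbit leaves the
ball `B̄(0, R)` at some time `t ≥ 0`. (Bounded + globally Lipschitz are the standing hypotheses
making the global flow `globalFlow` available.) See the module docstring for the proof, a
short-cut through the Poincaré–Bendixson argument (Hartman, *ODE*, Ch. VII §4) ending in the
Umlaufsatz. [cite: Hartman2002, Ch. VII §4, Thm. 4.1 and Thm. 3.1] -/
theorem exists_lt_norm_globalFlow (hX : ContDiff ℝ 1 X) (hK : LipschitzWith K X)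
    (hB : ∀ z, ‖X z‖ ≤ B) (hX0 : ∀ z, X z ≠ 0) (hlog : HasLogOn X univ) (z₀ : ℂ) (R : ℝ) :
    ∃ t : ℝ, 0 ≤ t ∧ R < ‖globalFlow hK hB z₀ t‖ := by
  by_contra hcon
  push Not at hcon
  /- ## Step 1: no point of the orbit recurs (no closed orbits) -/
  have hnp : ∀ a b : ℝ, globalFlow hK hB z₀ a = globalFlow hK hB z₀ b → a = b := by
    intro a b h
    by_contra hab
    refine false_of_globalFlow_eq_self hX hK hB hX0 hlog (p := globalFlow hK hB z₀ a) (P := b - a)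
      (sub_ne_zero.2 (Ne.symm hab)) ?_
    rw [← globalFlow_add, show a + (b - a) = b by ring, ← h]
  /- ## Step 2: an `ω`-limit point `q` -/
  have hmem : ∀ n : ℕ, globalFlow hK hB z₀ n ∈ closedBall (0 : ℂ) R := fun n =>
    mem_closedBall_zero_iff.2 (hcon n (Nat.cast_nonneg n))
  obtain ⟨q, -, ψ, hψ, hlim⟩ := (isCompact_closedBall (0 : ℂ) R).tendsto_subseq hmem
  have hret : ∀ η > 0, ∀ T : ℝ, ∃ t : ℝ, T ≤ t ∧ dist (globalFlow hK hB z₀ t) q < η := by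
    intro η hη T
    obtain ⟨N, hN⟩ := Filter.eventually_atTop.1 ((Metric.tendsto_nhds.1 hlim) η hη)
    obtain ⟨n, hn⟩ := exists_nat_ge T
    refine ⟨ψ (max N n), ?_, hN _ (le_max_left _ _)⟩
    calc T ≤ n := hn
      _ ≤ ((max N n : ℕ) : ℝ) := by exact_mod_cast le_max_right _ _
      _ ≤ ψ (max N n) := by exact_mod_cast hψ.id_le _
  /- ## Step 3: the flow box at `q` -/
  have hq : X q ≠ 0 := hX0 q
  obtain ⟨δ₀, hδ₀, hinj, hopen⟩ := exists_flowBox hX hK hB q hq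
  set Ψ : ℝ × ℝ → ℂ := fun p => globalFlow hK hB (q + (p.2 : ℂ) * (I * X q)) p.1 with hΨ_def
  have hΨC1 : ContDiff ℝ 1 Ψ :=
    (contDiff_globalFlow hX le_rfl hK hB).comp
      ((contDiff_const.add ((ofRealCLM.contDiff.comp contDiff_snd).mul contDiff_const)).prodMk contDiff_fst)
  have hΨzero : ∀ r : ℝ, Ψ (0, r) = q + (r : ℂ) * (I * X q) := fun r => globalFlow_zero hK hB _
  have hΨflow : ∀ t s r : ℝ, globalFlow hK hB (Ψ (t, r)) s = Ψ (t + s, r) := fun t s r =>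
    (globalFlow_add hK hB _ t s).symm
  have hΨderiv_t : ∀ p : ℝ × ℝ, fderiv ℝ Ψ p ((1 : ℝ), (0 : ℝ)) = X (Ψ p) := fun p =>
    fderiv_flowBox_one_zero hX hK hB q (I * X q) p
  /- ## Step 4: bounds on the box and the scales `δ`, `δ₁`, `η` -/
  set δ : ℝ := δ₀ / 4 with hδ_def
  have hδ0 : 0 < δ := by positivity
  obtain ⟨M, hM0, hM⟩ : ∃ M : ℝ, 0 < M ∧ ∀ p ∈ closedBall (0 : ℝ × ℝ) δ₀,
      ‖fderiv ℝ Ψ p ((0 : ℝ), (1 : ℝ))‖ ≤ M := by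
    have hc : Continuous fun p : ℝ × ℝ => fderiv ℝ Ψ p ((0 : ℝ), (1 : ℝ)) :=
      (hΨC1.continuous_fderiv (by simp)).clm_apply continuous_const
    obtain ⟨C, hC⟩ := (isCompact_closedBall (0 : ℝ × ℝ) δ₀).exists_bound_of_continuousOn hc.continuousOn
    exact ⟨max C 1, by positivity, fun p hp => (hC p hp).trans (le_max_left _ _)⟩
  obtain ⟨m, hm0, hm⟩ : ∃ m : ℝ, 0 < m ∧ ∀ p ∈ closedBall (0 : ℝ × ℝ) δ₀, m ≤ ‖X (Ψ p)‖ := by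
    have hc : Continuous fun p : ℝ × ℝ => ‖X (Ψ p)‖ := (hX.continuous.comp hΨC1.continuous).norm
    obtain ⟨p₀, -, hmin⟩ := (isCompact_closedBall (0 : ℝ × ℝ) δ₀).exists_isMinOn
      ⟨0, mem_closedBall_self hδ₀.le⟩ hc.continuousOn
    exact ⟨‖X (Ψ p₀)‖, norm_pos_iff.2 (hX0 _), fun p hp => hmin hp⟩
  obtain ⟨hχ0, hχ1, C, hC0, hC⟩ := deriv_smoothTransition_eq_zero
  set δ₁ : ℝ := min (δ₀ / 4) (δ * m / (4 * C * M)) with hδ₁_def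
  have hδ₁0 : 0 < δ₁ := lt_min (by positivity) (by positivity)
  have hδ₁δ : δ₁ ≤ δ := min_le_left _ _
  have hδ₁δ₀ : δ₁ ≤ δ₀ := by linarith
  have hδ₁key : δ₁ * C / δ * M ≤ m / 4 := by
    have h1 : δ₁ ≤ δ * m / (4 * C * M) := min_le_right _ _
    rw [le_div_iff₀ (by positivity)] at h1
    rw [div_mul_eq_mul_div, div_le_iff₀ hδ0]
    nlinarith
  obtain ⟨η, hη0, hη⟩ := hopen δ₁ hδ₁0 hδ₁δ₀
  /- ## Step 5: hits on the transversal `Ψ (0, ·)` -/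
  set H : Set ℝ := {t | ∃ r ∈ Icc (-δ₁) δ₁, globalFlow hK hB z₀ t = q + (r : ℂ) * (I * X q)} with hH_def
  have hHclosed : IsClosed H := by
    have hK' : IsCompact ((fun r : ℝ => q + (r : ℂ) * (I * X q)) '' Icc (-δ₁) δ₁) :=
      isCompact_Icc.image (by fun_prop)
    have : H = (fun t => globalFlow hK hB z₀ t) ⁻¹' ((fun r : ℝ => q + (r : ℂ) * (I * X q)) '' Icc (-δ₁) δ₁) := by
      ext t
      simp only [hH_def, mem_setOf_eq, mem_preimage, mem_image]
      constructor
      · rintro ⟨r, hr, h⟩; exact ⟨r, hr, h.symm⟩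
      · rintro ⟨r, hr, h⟩; exact ⟨r, hr, h.symm⟩
    rw [this]
    exact hK'.isClosed.preimage (continuous_globalFlow hK hB z₀)
  -- the orbit returns to the transversal at arbitrarily late times
  have hHret : ∀ T : ℝ, ∃ t ∈ H, T ≤ t := by
    intro T
    obtain ⟨t, hTt, hdist⟩ := hret η hη0 (T + δ₀)
    obtain ⟨p, hp, hpt⟩ := hη (mem_ball.2 hdist)
    have hp' : |p.1| < δ₁ ∧ |p.2| < δ₁ := by
      have := mem_ball_zero_iff.1 hp
      rw [Prod.norm_def, max_lt_iff, Real.norm_eq_abs, Real.norm_eq_abs] at this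
      exact this
    refine ⟨t - p.1, ⟨p.2, ⟨by linarith [(abs_lt.1 hp'.2).1], (abs_lt.1 hp'.2).2.le⟩, ?_⟩,
      by linarith [(abs_lt.1 hp'.1).2]⟩
    calc globalFlow hK hB z₀ (t - p.1) = globalFlow hK hB (globalFlow hK hB z₀ t) (-p.1) := by
          rw [← globalFlow_add, ← sub_eq_add_neg]
      _ = globalFlow hK hB (Ψ (p.1, p.2)) (-p.1) := by rw [← hpt]
      _ = q + (p.2 : ℂ) * (I * X q) := by rw [hΨflow, add_neg_cancel, hΨzero]
  -- distinct hits are more than `δ₀` apart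
  have hHsep : ∀ s ∈ H, ∀ t ∈ H, s < t → t ≤ s + δ₀ → False := by
    rintro s ⟨r, hr, hs⟩ t ⟨r', hr', ht⟩ hst hts
    have e1 : globalFlow hK hB z₀ t = Ψ (t - s, r) := by
      have : globalFlow hK hB z₀ t = globalFlow hK hB (globalFlow hK hB z₀ s) (t - s) := by
        rw [← globalFlow_add, add_sub_cancel]
      rw [this, hs, ← hΨzero r, hΨflow, zero_add]
    have e2 : globalFlow hK hB z₀ t = Ψ (0, r') := by rw [ht, hΨzero]
    have hb1 : ((t - s, r) : ℝ × ℝ) ∈ closedBall (0 : ℝ × ℝ) δ₀ :=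
      mk_mem_closedBall_prod (by rw [abs_le]; constructor <;> linarith)
        ((abs_le.2 ⟨hr.1, hr.2⟩).trans hδ₁δ₀)
    have hb2 : (((0 : ℝ), r') : ℝ × ℝ) ∈ closedBall (0 : ℝ × ℝ) δ₀ :=
      mk_mem_closedBall_prod (by rw [abs_zero]; exact hδ₀.le) ((abs_le.2 ⟨hr'.1, hr'.2⟩).trans hδ₁δ₀)
    have := hinj hb1 hb2 (e1.symm.trans e2)
    have := congrArg Prod.fst this
    simp only at this
    linarith
  -- a first hit `t₁ ≥ 0` and the next one `t₂`
  obtain ⟨t₁, ht₁H, ht₁0⟩ := hHret 0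
  have hSne : (H ∩ Ici (t₁ + δ₀)).Nonempty := by
    obtain ⟨t, ht, hle⟩ := hHret (t₁ + δ₀); exact ⟨t, ht, hle⟩
  have hSclosed : IsClosed (H ∩ Ici (t₁ + δ₀)) := hHclosed.inter isClosed_Ici
  have hSbdd : BddBelow (H ∩ Ici (t₁ + δ₀)) := ⟨t₁ + δ₀, fun t ht => ht.2⟩
  obtain ⟨ht₂mem, ht₂min⟩ : sInf (H ∩ Ici (t₁ + δ₀)) ∈ H ∩ Ici (t₁ + δ₀) ∧
      ∀ t ∈ H ∩ Ici (t₁ + δ₀), sInf (H ∩ Ici (t₁ + δ₀)) ≤ t :=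
    ⟨hSclosed.csInf_mem hSne hSbdd, fun t ht => csInf_le hSbdd ht⟩
  set t₂ : ℝ := sInf (H ∩ Ici (t₁ + δ₀)) with ht₂_def
  obtain ⟨r₁, hr₁, hzt₁⟩ := ht₁H
  obtain ⟨r₂, hr₂, hzt₂⟩ := ht₂mem.1
  have ht₁₂ : t₁ + δ₀ ≤ t₂ := ht₂mem.2
  set P : ℝ := t₂ - t₁ with hP_def
  have hP0 : 0 < P := by linarith
  have hδP : 2 * δ < P := by linarith
  have hr₁abs : |r₁| ≤ δ₁ := abs_le.2 ⟨hr₁.1, hr₁.2⟩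
  have hr₂abs : |r₂| ≤ δ₁ := abs_le.2 ⟨hr₂.1, hr₂.2⟩
  -- the hits within `δ₀` of `[t₁, t₂]` are `t₁` and `t₂` only
  have hnoHit : ∀ h ∈ H, t₁ - δ₀ ≤ h → h ≤ t₂ + δ₀ → h = t₁ ∨ h = t₂ := by
    intro h hh h1 h2
    rcases lt_trichotomy h t₁ with hlt | heq | hgt
    · exact (hHsep h hh t₁ ⟨r₁, hr₁, hzt₁⟩ hlt (by linarith)).elim
    · exact Or.inl heq
    rcases lt_trichotomy h t₂ with hlt2 | heq2 | hgt2
    · exfalso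
      by_cases hle : h ≤ t₁ + δ₀
      · exact hHsep t₁ ⟨r₁, hr₁, hzt₁⟩ h hh hgt hle
      · exact absurd (ht₂min h ⟨hh, le_of_lt (not_le.1 hle)⟩) (not_le.2 hlt2)
    · exact Or.inr heq2
    · exact (hHsep t₂ ⟨r₂, hr₂, hzt₂⟩ h hh hgt2 (by linarith)).elim
  -- box coordinates of the orbit through the two hits
  have horb₁ : ∀ s : ℝ, globalFlow hK hB z₀ (t₁ + s) = Ψ (s, r₁) := by
    intro s; rw [globalFlow_add, hzt₁, ← hΨzero r₁, hΨflow, zero_add]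
  have horb₂ : ∀ s : ℝ, globalFlow hK hB z₀ (t₂ + s) = Ψ (s, r₂) := by
    intro s; rw [globalFlow_add, hzt₂, ← hΨzero r₂, hΨflow, zero_add]
  have hr₁₂ : r₁ ≠ r₂ := by
    intro h
    have : globalFlow hK hB z₀ t₁ = globalFlow hK hB z₀ t₂ := by rw [hzt₁, hzt₂, h]
    have := hnp _ _ this
    linarith
  /- ## Step 6: no other passage of the orbit arc `[t₁, t₂]` through the thin box -/
  have hNOP : ∀ t ∈ Icc t₁ t₂, ∀ a b : ℝ, |a| ≤ δ₀ → |b| ≤ δ₁ → globalFlow hK hB z₀ t = Ψ (a, b) →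
      (a = t - t₁ ∧ b = r₁) ∨ (a = t - t₂ ∧ b = r₂) := by
    intro t ht a b ha hb h
    have hhit : t - a ∈ H := by
      refine ⟨b, ⟨(abs_le.1 hb).1, (abs_le.1 hb).2⟩, ?_⟩
      rw [show t - a = t + -a by ring, globalFlow_add, h, hΨflow, add_neg_cancel, hΨzero]
    rcases hnoHit (t - a) hhit (by linarith [ht.1, (abs_le.1 ha).2]) (by linarith [ht.2, (abs_le.1 ha).1])
      with h1 | h2
    · left
      have ha' : a = t - t₁ := by linarith
      refine ⟨ha', ?_⟩
      have e : Ψ (a, b) = Ψ (a, r₁) := by rw [← h, show t = t₁ + a by linarith, horb₁]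
      have := hinj (mk_mem_closedBall_prod ha (hb.trans hδ₁δ₀)) (mk_mem_closedBall_prod ha (hr₁abs.trans hδ₁δ₀)) e
      exact (Prod.mk.inj this).2
    · right
      have ha' : a = t - t₂ := by linarith
      refine ⟨ha', ?_⟩
      have e : Ψ (a, b) = Ψ (a, r₂) := by rw [← h, show t = t₂ + a by linarith, horb₂]
      have := hinj (mk_mem_closedBall_prod ha (hb.trans hδ₁δ₀)) (mk_mem_closedBall_prod ha (hr₂abs.trans hδ₁δ₀)) e
      exact (Prod.mk.inj this).2
  /- ## Step 7: the descent profile `g` and the curve `E v = Ψ (v - δ, g v)` -/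
  have h2δ : 0 < 2 * δ := by positivity
  have hg_left : ∀ v ≤ 0, r₂ + (r₁ - r₂) * Real.smoothTransition (v / (2 * δ)) = r₂ := fun v hv => by
    rw [Real.smoothTransition.zero_of_nonpos (div_nonpos_of_nonpos_of_nonneg hv h2δ.le), mul_zero, add_zero]
  have hg_right : ∀ v, 2 * δ ≤ v → r₂ + (r₁ - r₂) * Real.smoothTransition (v / (2 * δ)) = r₁ := fun v hv => by
    rw [Real.smoothTransition.one_of_one_le ((one_le_div h2δ).2 hv), mul_one, add_sub_cancel]
  have hg_mem : ∀ v, |r₂ + (r₁ - r₂) * Real.smoothTransition (v / (2 * δ))| ≤ δ₁ := by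
    intro v
    have h0 := Real.smoothTransition.nonneg (v / (2 * δ))
    have h1 := Real.smoothTransition.le_one (v / (2 * δ))
    rw [abs_le]
    obtain ⟨l₁, u₁⟩ := hr₁
    obtain ⟨l₂, u₂⟩ := hr₂
    constructor <;> nlinarith
  have hg_smooth : ContDiff ℝ 1 fun v : ℝ => r₂ + (r₁ - r₂) * Real.smoothTransition (v / (2 * δ)) :=
    contDiff_const.add (contDiff_const.mul (Real.smoothTransition.contDiff.comp (contDiff_id.div_const _)))
  have hg_deriv : ∀ v, HasDerivAt (fun v : ℝ => r₂ + (r₁ - r₂) * Real.smoothTransition (v / (2 * δ)))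
      ((r₁ - r₂) * (deriv Real.smoothTransition (v / (2 * δ)) / (2 * δ))) v := by
    intro v
    have h1 : HasDerivAt (fun v : ℝ => v / (2 * δ)) (1 / (2 * δ)) v := (hasDerivAt_id v).div_const _
    have h2 : HasDerivAt Real.smoothTransition (deriv Real.smoothTransition (v / (2 * δ))) (v / (2 * δ)) :=
      ((Real.smoothTransition.contDiff (n := 1)).differentiable (by simp) _).hasDerivAt
    have h3 : HasDerivAt (fun v : ℝ => Real.smoothTransition (v / (2 * δ)))
        (deriv Real.smoothTransition (v / (2 * δ)) * (1 / (2 * δ))) v := by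
      have := HasDerivAt.comp v h2 h1
      exact this
    have h4 := (h3.const_mul (r₁ - r₂)).const_add r₂
    have e : (r₁ - r₂) * (deriv Real.smoothTransition (v / (2 * δ)) * (1 / (2 * δ))) =
        (r₁ - r₂) * (deriv Real.smoothTransition (v / (2 * δ)) / (2 * δ)) := by ring
    rw [e] at h4
    exact h4
  have hg'_bound : ∀ v, |(r₁ - r₂) * (deriv Real.smoothTransition (v / (2 * δ)) / (2 * δ))| ≤ δ₁ * C / δ := by
    intro v
    have h1 : |r₁ - r₂| ≤ 2 * δ₁ := by
      rw [abs_le]; obtain ⟨l₁, u₁⟩ := hr₁; obtain ⟨l₂, u₂⟩ := hr₂; constructor <;> linarith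
    rw [abs_mul, abs_div, abs_of_pos h2δ]
    calc |r₁ - r₂| * (|deriv Real.smoothTransition (v / (2 * δ))| / (2 * δ))
        ≤ (2 * δ₁) * (C / (2 * δ)) := mul_le_mul h1 (div_le_div_of_nonneg_right (hC _) h2δ.le)
          (by positivity) (by positivity)
      _ = δ₁ * C / δ := by field_simp
  have hg'_zero : ∀ v, (v ≤ 0 ∨ 2 * δ ≤ v) →
      (r₁ - r₂) * (deriv Real.smoothTransition (v / (2 * δ)) / (2 * δ)) = 0 := by
    intro v hv
    rcases hv with hv | hv
    · rw [hχ0 _ (div_nonpos_of_nonpos_of_nonneg hv h2δ.le)]; simp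
    · rw [hχ1 _ ((one_le_div h2δ).2 hv)]; simp
  -- the curve `E`
  set E : ℝ → ℂ := fun v => Ψ (v - δ, r₂ + (r₁ - r₂) * Real.smoothTransition (v / (2 * δ))) with hE_def
  have hEC1 : ContDiff ℝ 1 E := hΨC1.comp ((contDiff_id.sub contDiff_const).prodMk hg_smooth)
  have hE_left : ∀ v ≤ 0, E v = globalFlow hK hB z₀ (t₂ - δ + v) := by
    intro v hv
    simp only [hE_def, hg_left v hv]
    rw [show t₂ - δ + v = t₂ + (v - δ) by ring, horb₂]
  have hE_right : ∀ v, 2 * δ ≤ v → E v = globalFlow hK hB z₀ (t₁ - δ + v) := by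
    intro v hv
    simp only [hE_def, hg_right v hv]
    rw [show t₁ - δ + v = t₁ + (v - δ) by ring, horb₁]
  have hE_shift : ∀ v, 2 * δ ≤ v → v ≤ P → E v = E (v - P) := by
    intro v h1 h2
    rw [hE_right v h1, hE_left (v - P) (by linarith)]
    congr 1
    rw [hP_def]; ring
  -- derivative of `E`: `X (E v) + g' v • ∂_r Ψ`
  have hE_deriv : ∀ v, HasDerivAt E (X (E v) +
      ((r₁ - r₂) * (deriv Real.smoothTransition (v / (2 * δ)) / (2 * δ))) •
        fderiv ℝ Ψ (v - δ, r₂ + (r₁ - r₂) * Real.smoothTransition (v / (2 * δ))) ((0 : ℝ), (1 : ℝ))) v := by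
    intro v
    have h1 : HasFDerivAt Ψ (fderiv ℝ Ψ (v - δ, r₂ + (r₁ - r₂) * Real.smoothTransition (v / (2 * δ))))
        (v - δ, r₂ + (r₁ - r₂) * Real.smoothTransition (v / (2 * δ))) :=
      (hΨC1.differentiable (by simp) _).hasFDerivAt
    have h2 : HasDerivAt (fun v : ℝ => ((v - δ, r₂ + (r₁ - r₂) * Real.smoothTransition (v / (2 * δ))) : ℝ × ℝ))
        ((1 : ℝ), (r₁ - r₂) * (deriv Real.smoothTransition (v / (2 * δ)) / (2 * δ))) v :=
      ((hasDerivAt_id v).sub_const δ).prodMk (hg_deriv v)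
    have h3 := h1.comp_hasDerivAt v h2
    have e : fderiv ℝ Ψ (v - δ, r₂ + (r₁ - r₂) * Real.smoothTransition (v / (2 * δ)))
        ((1 : ℝ), (r₁ - r₂) * (deriv Real.smoothTransition (v / (2 * δ)) / (2 * δ))) =
        X (E v) + ((r₁ - r₂) * (deriv Real.smoothTransition (v / (2 * δ)) / (2 * δ))) •
          fderiv ℝ Ψ (v - δ, r₂ + (r₁ - r₂) * Real.smoothTransition (v / (2 * δ))) ((0 : ℝ), (1 : ℝ)) := by
      have : (((1 : ℝ), (r₁ - r₂) * (deriv Real.smoothTransition (v / (2 * δ)) / (2 * δ))) : ℝ × ℝ) =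
          (((1 : ℝ), (0 : ℝ)) : ℝ × ℝ) +
            ((r₁ - r₂) * (deriv Real.smoothTransition (v / (2 * δ)) / (2 * δ))) • (((0 : ℝ), (1 : ℝ)) : ℝ × ℝ) := by
        ext <;> simp
      rw [this, map_add, map_smul, hΨderiv_t]
    rw [e] at h3
    exact h3
  -- the distortion is at most half the field
  have hζ : ∀ v, ‖((r₁ - r₂) * (deriv Real.smoothTransition (v / (2 * δ)) / (2 * δ))) •
      fderiv ℝ Ψ (v - δ, r₂ + (r₁ - r₂) * Real.smoothTransition (v / (2 * δ))) ((0 : ℝ), (1 : ℝ))‖ ≤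
        ‖X (E v)‖ / 2 := by
    intro v
    by_cases hv : v ≤ 0 ∨ 2 * δ ≤ v
    · rw [hg'_zero v hv, zero_smul, norm_zero]; positivity
    · rw [not_or, not_le, not_le] at hv
      have hbox : ((v - δ, r₂ + (r₁ - r₂) * Real.smoothTransition (v / (2 * δ))) : ℝ × ℝ) ∈
          closedBall (0 : ℝ × ℝ) δ₀ :=
        mk_mem_closedBall_prod (by rw [abs_le]; constructor <;> linarith) ((hg_mem v).trans hδ₁δ₀)
      rw [norm_smul, Real.norm_eq_abs]
      calc |(r₁ - r₂) * (deriv Real.smoothTransition (v / (2 * δ)) / (2 * δ))| *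
            ‖fderiv ℝ Ψ (v - δ, r₂ + (r₁ - r₂) * Real.smoothTransition (v / (2 * δ))) ((0 : ℝ), (1 : ℝ))‖
          ≤ (δ₁ * C / δ) * M := mul_le_mul (hg'_bound v) (hM _ hbox) (norm_nonneg _) (by positivity)
        _ ≤ m / 4 := hδ₁key
        _ ≤ ‖X (E v)‖ / 2 := by linarith [hm _ hbox]
  have hEkey : ∀ v, deriv E v ≠ 0 ∧ X (E v) / deriv E v ∈ slitPlane := fun v => by
    rw [(hE_deriv v).deriv]
    exact div_add_mem_slitPlane (hX0 _) (hζ v)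
  /- ## Step 8: the periodic curve `c` -/
  set a₀ : ℝ := (2 * δ - P) / 2 with ha₀_def
  set μ : ℝ := (P - 2 * δ) / 2 with hμ_def
  have hμ0 : 0 < μ := by rw [hμ_def]; linarith
  set c : ℝ → ℂ := fun s => E (toIcoMod hP0 a₀ s) with hc_def
  have hc_per : Periodic c P := fun s => by simp only [hc_def]; rw [toIcoMod_add_right]
  -- `c = E` on a neighbourhood of a full period
  have hcE : ∀ s ∈ Ioo (a₀ - μ) (a₀ + P + μ), c s = E s := by
    intro s hs
    simp only [hc_def]
    rcases lt_or_ge s a₀ with h1 | h1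
    · have e : toIcoMod hP0 a₀ s = s + P := by
        rw [toIcoMod_eq_iff hP0]
        exact ⟨⟨by linarith [hs.1], by linarith⟩, -1, by simp⟩
      rw [e, hE_shift (s + P) (by linarith [hs.1]) (by linarith), add_sub_cancel_right]
    rcases lt_or_ge s (a₀ + P) with h2 | h2
    · rw [(toIcoMod_eq_self hP0).2 ⟨h1, h2⟩]
    · have e : toIcoMod hP0 a₀ s = s - P := by
        rw [toIcoMod_eq_iff hP0]
        exact ⟨⟨by linarith, by linarith [hs.2]⟩, 1, by simp⟩
      rw [e, ← hE_shift s (by linarith) (by linarith [hs.2])]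
  -- local representation `c = E (· - k P)` near every point
  have hcloc : ∀ s, ∃ k : ℤ, (fun s' => c s') =ᶠ[𝓝 s] fun s' => E (s' - k • P) := by
    intro s
    refine ⟨toIcoDiv hP0 a₀ s, ?_⟩
    have hmemI : s - toIcoDiv hP0 a₀ s • P ∈ Ioo (a₀ - μ) (a₀ + P + μ) := by
      have := toIcoMod_mem_Ico hP0 a₀ s
      rw [← self_sub_toIcoDiv_zsmul] at this
      exact ⟨by linarith [this.1], by linarith [this.2]⟩
    have hopen' : IsOpen ((fun s' : ℝ => s' - toIcoDiv hP0 a₀ s • P) ⁻¹' Ioo (a₀ - μ) (a₀ + P + μ)) :=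
      isOpen_Ioo.preimage (by fun_prop)
    filter_upwards [hopen'.mem_nhds hmemI] with s' hs'
    rw [← hcE _ hs']
    exact (hc_per.sub_zsmul_eq _).symm
  have hcC1 : ContDiff ℝ 1 c := contDiff_iff_contDiffAt.2 fun s => by
    obtain ⟨k, hk⟩ := hcloc s
    exact ((hEC1.comp (contDiff_id.sub contDiff_const)).contDiffAt).congr_of_eventuallyEq hk
  have hcderiv : ∀ s, ∃ k : ℤ, c s = E (s - k • P) ∧ deriv c s = deriv E (s - k • P) := by
    intro s
    obtain ⟨k, hk⟩ := hcloc s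
    refine ⟨k, hk.self_of_nhds, ?_⟩
    rw [hk.deriv_eq]
    exact deriv_comp_sub_const _ _ _
  have hcreg : ∀ s, deriv c s ≠ 0 := fun s => by
    obtain ⟨k, -, hd⟩ := hcderiv s
    rw [hd]; exact (hEkey _).1
  have hcslit : ∀ s, X (c s) / deriv c s ∈ slitPlane := fun s => by
    obtain ⟨k, hcs, hd⟩ := hcderiv s
    rw [hd, hcs]; exact (hEkey _).2
  /- ## Step 9: `E` is injective on a period window, so `c` is injective modulo `P` -/
  have ha₀neg : a₀ < 0 := by rw [ha₀_def]; linarith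
  have ha₀P : a₀ + P = δ + P / 2 := by rw [ha₀_def]; ring
  -- the bend against the orbit pieces
  have hmix : ∀ u ∈ Ico a₀ (a₀ + P), ∀ u' ∈ Ico a₀ (a₀ + P), (u < 0 ∨ 2 * δ ≤ u) → (0 ≤ u' ∧ u' < 2 * δ) →
      E u = E u' → False := by
    intro u hu u' hu' hcase hb h
    -- the orbit point `E u = Φ_τ z₀` with `τ ∈ [t₁, t₂]`
    obtain ⟨τ, hτ, hEu, hτval⟩ : ∃ τ ∈ Icc t₁ t₂, E u = globalFlow hK hB z₀ τ ∧
        (τ = t₂ - δ + u ∨ τ = t₁ - δ + u) := by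
      rcases hcase with h1 | h1
      · exact ⟨t₂ - δ + u, ⟨by linarith [hu.1], by linarith⟩, hE_left u h1.le, Or.inl rfl⟩
      · exact ⟨t₁ - δ + u, ⟨by linarith, by linarith [hu.2]⟩, hE_right u h1, Or.inr rfl⟩
    have hΨeq : globalFlow hK hB z₀ τ = Ψ (u' - δ, r₂ + (r₁ - r₂) * Real.smoothTransition (u' / (2 * δ))) := by
      rw [← hEu, h]
    rcases hNOP τ hτ _ _ (by rw [abs_le]; constructor <;> linarith [hb.1, hb.2]) (hg_mem u') hΨeq with
      ⟨hA, -⟩ | ⟨hB', -⟩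
    · -- `u' - δ = τ - t₁`
      rcases hτval with rfl | rfl
      · -- τ = t₂ - δ + u: u' = P + u ≥ a₀ + P
        have : u' = P + u := by rw [hP_def]; linarith
        linarith [hu.1, hu'.2]
      · -- τ = t₁ - δ + u: u' = u ≥ 2δ
        have : u' = u := by linarith
        rcases hcase with h1 | h1 <;> linarith [hb.1, hb.2]
    · -- `u' - δ = τ - t₂`
      rcases hτval with rfl | rfl
      · have : u' = u := by linarith
        rcases hcase with h1 | h1 <;> linarith [hb.1, hb.2]
      · have : u' = u - P := by rw [hP_def]; linarith
        linarith [hu.2, hb.1]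
  have hEinj : InjOn E (Ico a₀ (a₀ + P)) := by
    intro u hu u' hu' h
    by_cases hbu : 0 ≤ u ∧ u < 2 * δ
    · by_cases hbu' : 0 ≤ u' ∧ u' < 2 * δ
      · -- bend against bend: injectivity of the box
        have hb1 : ((u - δ, r₂ + (r₁ - r₂) * Real.smoothTransition (u / (2 * δ))) : ℝ × ℝ) ∈
            closedBall (0 : ℝ × ℝ) δ₀ :=
          mk_mem_closedBall_prod (by rw [abs_le]; constructor <;> linarith [hbu.1, hbu.2]) ((hg_mem u).trans hδ₁δ₀)
        have hb2 : ((u' - δ, r₂ + (r₁ - r₂) * Real.smoothTransition (u' / (2 * δ))) : ℝ × ℝ) ∈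
            closedBall (0 : ℝ × ℝ) δ₀ :=
          mk_mem_closedBall_prod (by rw [abs_le]; constructor <;> linarith [hbu'.1, hbu'.2]) ((hg_mem u').trans hδ₁δ₀)
        have := congrArg Prod.fst (hinj hb1 hb2 h)
        simp only at this
        linarith
      · rw [not_and_or, not_le, not_lt] at hbu'
        exact (hmix u' hu' u hu hbu' hbu h.symm).elim
    · rw [not_and_or, not_le, not_lt] at hbu
      by_cases hbu' : 0 ≤ u' ∧ u' < 2 * δ
      · exact (hmix u hu u' hu' hbu hbu' h).elim
      · rw [not_and_or, not_le, not_lt] at hbu'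
        -- orbit against orbit: no recurrence
        have key : ∀ w ∈ Ico a₀ (a₀ + P), (w < 0 ∨ 2 * δ ≤ w) →
            ∃ τ, E w = globalFlow hK hB z₀ τ ∧ ((w < 0 ∧ τ = t₂ - δ + w) ∨ (2 * δ ≤ w ∧ τ = t₁ - δ + w)) := by
          intro w hw hc
          rcases hc with h1 | h1
          · exact ⟨_, hE_left w h1.le, Or.inl ⟨h1, rfl⟩⟩
          · exact ⟨_, hE_right w h1, Or.inr ⟨h1, rfl⟩⟩
        obtain ⟨τ, hτ, hτc⟩ := key u hu hbu
        obtain ⟨τ', hτ', hτc'⟩ := key u' hu' hbu'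
        have hττ' : τ = τ' := hnp _ _ (by rw [← hτ, ← hτ', h])
        rcases hτc with ⟨h1, rfl⟩ | ⟨h1, rfl⟩ <;> rcases hτc' with ⟨h2, h3⟩ | ⟨h2, h3⟩
        · linarith
        · exfalso
          have : u' = u + P := by rw [hP_def]; linarith
          linarith [hu.1, hu'.2]
        · exfalso
          have : u = u' + P := by rw [hP_def]; linarith
          linarith [hu'.1, hu.2]
        · linarith
  have hcinj : ∀ ⦃s t : ℝ⦄, c s = c t → ∃ m : ℤ, t = s + m * P := by
    intro s t hst
    have h1 := hEinj (toIcoMod_mem_Ico hP0 a₀ s) (toIcoMod_mem_Ico hP0 a₀ t) hst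
    obtain ⟨n, hn⟩ := (toIcoMod_eq_toIcoMod hP0).1 h1
    exact ⟨n, by rw [zsmul_eq_mul] at hn; linarith⟩
  /- ## Step 10: the winding number of `X` along `c` is `±1` and `0` -/
  have hV : Continuous fun s => X (c s) := hX.continuous.comp hcC1.continuous
  have hVper : Periodic (fun s => X (c s)) P := fun s => by
    show X (c (s + P)) = X (c s)
    rw [hc_per]
  have hw := wind_eq_one_or_eq_neg_one_of_div_mem_slitPlane hP0 hcC1 hc_per hcinj hcreg hV hVper hcslit
  obtain ⟨Θ, hΘc, hΘe⟩ := hlog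
  have hw0 : wind (fun u => X (c (P * u))) = 0 := by
    have e : (fun u => X (c (P * u))) = fun u => exp (Θ (c (P * u))) :=
      funext fun u => (hΘe _ (mem_univ _)).symm
    rw [e]
    refine wind_exp_eq_zero ((continuousOn_univ.1 hΘc).comp
      (hcC1.continuous.comp (continuous_const.mul continuous_id))).continuousOn ?_
    simp only [mul_zero, mul_one]
    have := hc_per 0
    rw [zero_add] at this
    rw [this]
  rw [hw0] at hw
  norm_num at hw

/-- **Backward semi-orbits are unbounded too** (apply `exists_lt_norm_globalFlow` to `-X`, whose
flow is the time-reversed flow). [cite: Hartman2002, Ch. VII §4] -/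
theorem exists_lt_norm_globalFlow_of_nonpos (hX : ContDiff ℝ 1 X) (hK : LipschitzWith K X)
    (hB : ∀ z, ‖X z‖ ≤ B) (hX0 : ∀ z, X z ≠ 0) (hlog : HasLogOn X univ) (z₀ : ℂ) (R : ℝ) :
    ∃ t : ℝ, t ≤ 0 ∧ R < ‖globalFlow hK hB z₀ t‖ := by
  have hX' : ContDiff ℝ 1 fun z => -X z := hX.neg
  have hK' : LipschitzWith K fun z => -X z := hK.neg
  have hB' : ∀ z, ‖-X z‖ ≤ B := fun z => by rw [norm_neg]; exact hB z
  have hX0' : ∀ z, -X z ≠ 0 := fun z => neg_ne_zero.2 (hX0 z)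
  have hlog' : HasLogOn (fun z => -X z) univ := by
    obtain ⟨Θ, hΘc, hΘe⟩ := hlog
    refine ⟨fun z => Θ z + π * I, hΘc.add continuousOn_const, fun z hz => ?_⟩
    rw [exp_add, hΘe z hz, exp_pi_mul_I]; ring
  obtain ⟨t, ht0, ht⟩ := exists_lt_norm_globalFlow hX' hK' hB' hX0' hlog' z₀ R
  -- the flow of `-X` is the time-reversal of the flow of `X`
  have hrev : globalFlow hK' hB' z₀ t = globalFlow hK hB z₀ (-t) := by
    have key := eqOn_globalFlow hK' hB' (γ := fun s => globalFlow hK hB z₀ (-s)) (a := -(|t| + 1))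
      (b := |t| + 1) ⟨by linarith [abs_nonneg t], by linarith [abs_nonneg t]⟩ (fun s _ => by
        have h := (hasDerivAt_globalFlow hK hB z₀ (-s)).scomp s (hasDerivAt_neg s)
        simp only [neg_one_smul] at h
        exact h)
    have ht' : t ∈ Ioo (-(|t| + 1)) (|t| + 1) := by
      constructor <;> cases abs_cases t <;> linarith
    have := key ht'
    simp only [neg_zero, globalFlow_zero] at this
    exact this.symm
  exact ⟨-t, by linarith, by rwa [← hrev]⟩

end Flow

end Literature.Analysis.ODE
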